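import Summits.BirchSwinnertonDyer.Rank1Residual.X4.KuriharaLevelLoweringDescent
import HarnessLib

/-!
# Level lowering kills Kurihara numbers WITHOUT the eigen-condition: the descent identity with a Hecke DEFECT, and the vanishing of the Kurihara sum of an `ℓ`-old difference `μ − μ∘[ℓ]` whenever the Kurihara numbers of the Hecke DERIVATIVES of `μ` vanish (cell `b2b-bsdres`, seat additive-p4 gen 30, line V51′ — lemma V of the two-prime additivity theorem)

HONEST FRAMING (verbatim, cell `b2b-bsdres`): the goal of the cell is to DELETE the COMBINATION-SHAPED
residual classes for ALL analytic-rank `≤ 1` curves over `ℚ` — "full BSD formula for every rank `≤ 1`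
curve in class `C`" assembled STRICTLY from published theorems — so that the rank-`≤ 1` remainder
becomes exactly the CONSTRUCTION-SHAPED classes, which are TYPED (missing-input Props), NOT attempted;
this is not "finishing BSD". This file: a research-route KERNEL LEMMA file (pure algebra over an
arbitrary commutative ring; no named fact, no conjecture, nothing booked; X4 stays
CONSTRUCTION-SHAPED).

## What is proved (and why)

Gen 20 (`X4/KuriharaLevelLoweringDescent.lean`) proved: for `μ` periodic and `T_q`-EIGEN with
eigenvalue `2` at every prime of the square-free `n`, the Kurihara sum of the `ℓ`-old difference
`μ − μ∘[ℓ]` at `n` vanishes; the certificate `[·]⁺_f ≡ μ − μ∘[ℓ]` then kills every Kurihara number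
(`∂^{(∞)} ≥ e`). For TWO defect primes the seat's instrument (gen 30, E8) shows that the decomposition
`[·]⁺_f ≡ (μ₁ − μ₁∘[ℓ₁]) + (μ₂ − μ₂∘[ℓ₂]) (mod p^k)` EXISTS at the predicted joint exponent
`k = ord_p c_{ℓ₁} + ord_p c_{ℓ₂}` (Pollack–Weston "quantitative level lowering", additivity of the
Tamagawa exponents) but NEVER with `T_q`-eigen components `μ_i` (the components are eigen only up to
`max_i ord_p c_{ℓ_i}`; the joint datum is a non-trivial class in `Ext¹`). The symbol-side mechanism for
non-eigen components needs the descent identity WITH A DEFECT. Writing `(H_q μ)(r) = ∑_{j mod q}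
μ((r+j)/q) + μ(q r)` (the Hecke transform; `μ` is eigen with eigenvalue `a` iff `H_q μ = a·μ`) and
`ν_q = H_q μ − 2μ` (the DEFECT at a Kolyvagin prime):

* `sum_fibre_lev_heckeTransform`, `sum_units_fibre_lev_heckeTransform` — the fibre sums of gen 20 part 1
  with `a·μ(b/m)` replaced by `(H_q μ)(b/m)` (no Hecke hypothesis at all).
* `Phi_mul_eq_defect` — THE DESCENT IDENTITY WITH DEFECT:
  `Φ_T^{(qm)}(μ) = Φ_T^{(m)}(ν_q) − ∑_{T' ⊊ T} (∏_{T∖T'} ψ_i(q⁻¹) + ∏_{T∖T'} ψ_i(q)) · Φ_{T'}^{(m)}(μ)`.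
* `Phi_eq_zero_of_ssubset_of_derivatives` — for a FAMILY `D U` (`U` a finite set of primes; think
  `D U = (∏_{q∈U}(H_q − 2)) μ`, the iterated Hecke derivatives) with `H_q (D U) = 2·D U + D (U ∪ {q})`:
  if the full Kurihara sums `Φ_{P(m)}^{(m)}(D U)` vanish for every NON-EMPTY `U` and every admissible
  `m`, then `Φ_T^{(n)}(D U) = 0` for every PROPER `T ⊊ P(n)` and every `U` (strong induction on `n` along
  the defect identity — each branch either takes a derivative or shrinks `T`).
* **`kuriharaSum_oldform_eq_zero_of_derivatives`** — MAIN: under the same hypothesis the Kurihara sum at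
  `n` of `D ∅ − (D ∅)∘[ℓ]` vanishes for `ℓ` prime to `n`. Gen 20's theorem is the case `D U = 0` for
  `U ≠ ∅`.

Role (line V51′, two-prime additivity theorem, memo `V51`): with `f = (1−[ℓ₁])α + (1−[ℓ₂])β` and a
`τ`-system `∏(H_q−2)α = (1−[ℓ₂])τ_U`, `∏(H_q−2)β = −(1−[ℓ₁])τ_U`, one corrects `α`, `β` by `(1−[ℓ₂])γ̃`,
`(1−[ℓ₁])γ̃` for a `γ̃` matching the finitely many Kurihara numbers of the `τ_U` (lemma S, next file),
after which this file's theorem applies to each component. Nothing here depends on that.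

## References

* B. Mazur, J. Tate, J. Teitelbaum, Invent. Math. 84 (1986), §I.4 (4.2) (the Hecke relation for
  modular symbols). [cite: MazurTateTeitelbaum1986Invent, §I.4 (4.2)]
* M. Kurihara, Contrib. Math. Comput. Sci. 7 (2014) 317–356, §1.1 (1)–(2). [cite: Kurihara2014, §1.1]
* R. Pollack, T. Weston, Compos. Math. 147 (2011) 1353–1381 (quantitative level lowering; why the
  non-eigen decomposition exists — not an input here). [cite: PollackWeston2011, Thm. 1.2 (via Kim–Ota Conj. 1.1)]
* C.-H. Kim, K. Ota, arXiv:1905.02926, Conj. 1.1 and Thm. 1.3 (additivity of Tamagawa exponents in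
  congruence ideals; not an input here). [cite: KimOta2019CongruenceIdeals, Conj. 1.1 and Thm. 1.3 (p. 3)]
-/

noncomputable section

open scoped MatrixGroups ModularForm

open CongruenceSubgroup Finset

open Literature.NumberTheory.EllipticCurves Literature.NumberTheory.EllipticCurves.ModularForms

namespace Summit.BirchSwinnertonDyer.Rank1Residual.LevelLowering

variable {R : Type*}

/-! ### §1 The Hecke transform `H_q μ` of a periodic function -/

section HeckeTransform

variable [CommRing R]

/-- The weight-`2` **Hecke transform** at the prime `q`: `(H_q μ)(r) = ∑_{j mod q} μ((r+j)/q) + μ(q r)`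
(MTT §I.4 (4.2)); `μ` is `T_q`-eigen with eigenvalue `a` iff `H_q μ = a·μ` (`heckeRel_iff_heckeTransform`).
[cite: MazurTateTeitelbaum1986Invent, §I.4 (4.2)] -/
def heckeTransform (q : ℕ) (μ : ℚ → R) : ℚ → R :=
  fun r ↦ (∑ j ∈ Finset.range q, μ ((r + j) / q)) + μ (q * r)

/-- The Hecke relation of gen 20 (`HeckeRel μ q a`) says exactly `H_q μ = a·μ` pointwise. [cite: MazurTateTeitelbaum1986Invent, §I.4 (4.2)] -/
theorem heckeRel_iff_heckeTransform {μ : ℚ → R} {q : ℕ} {a : R} :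
    HeckeRel μ q a ↔ ∀ r : ℚ, heckeTransform q μ r = a * μ r :=
  Iff.rfl

end HeckeTransform

/-! ### §2 Fibre sums without a Hecke hypothesis -/

section Fibres

variable [CommRing R] {μ : ℚ → R}

/-- **The full fibre sum, Hecke-free form**: `∑_{y ≡ b (m)} μ(y/qm) = (H_q μ)(b/m) − μ(qb/m)` (the lifts
of `b` are `b + jm`, `(b + jm)/(qm) = (b/m + j)/q`). [cite: MazurTateTeitelbaum1986Invent, §I.4 (4.2)] -/
theorem sum_fibre_lev_heckeTransform (hμ : IsPeriodic μ) (m q : ℕ) [NeZero m] [NeZero (q * m)]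
    (b : ZMod m) :
    ∑ y ∈ Finset.univ.filter (fun y : ZMod (q * m) ↦ ZMod.castHom (dvd_mul_left m q) (ZMod m) y = b),
      lev μ (q * m) y = lev (heckeTransform q μ) m b - lev μ m ((q : ZMod m) * b) := by
  have hm : (m : ℚ) ≠ 0 := by exact_mod_cast NeZero.ne m
  have hq : (q : ℚ) ≠ 0 := by
    have : q * m ≠ 0 := NeZero.ne (q * m)
    exact_mod_cast left_ne_zero_of_mul this
  rw [filter_castHom_eq_image m q b, Finset.sum_image (fibre_injOn m q b)]
  have hterm : ∀ j ∈ Finset.range q,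
      lev μ (q * m) ((b.val + j * m : ℕ) : ZMod (q * m)) = μ ((((b.val : ℚ) / m) + j) / q) := by
    intro j _
    rw [lev_natCast hμ]
    congr 1
    push_cast
    field_simp
  rw [Finset.sum_congr rfl hterm, lev_natCast_mul hμ, mul_div_assoc]
  exact eq_sub_of_add_eq rfl

/-- **The unit fibre sum, Hecke-free form**: for a unit `b` of `ℤ/m` (`q` prime, `q ∤ m`),
`∑_{v unit, v ≡ b} μ(v/qm) = (H_q μ)(b/m) − μ(qb/m) − μ(q⁻¹b/m)`. (Gen 20's `sum_units_fibre_lev` with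
`a·μ(b/m)` replaced by `(H_q μ)(b/m)`; same proof.) [folklore] -/
theorem sum_units_fibre_lev_heckeTransform (hμ : IsPeriodic μ) (m q : ℕ) [NeZero m] [NeZero (q * m)]
    (hq : q.Prime) (hmq : m.Coprime q) (b : (ZMod m)ˣ) :
    ∑ v ∈ Finset.univ.filter
        (fun v : (ZMod (q * m))ˣ ↦ ZMod.unitsMap (dvd_mul_left m q) v = b),
      lev μ (q * m) (v : ZMod (q * m)) =
      lev (heckeTransform q μ) m b - lev μ m ((q : ZMod m) * b) -
        lev μ m ((b * (ZMod.unitOfCoprime q hmq.symm)⁻¹ : (ZMod m)ˣ) : ZMod m) := by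
  classical
  set π := ZMod.castHom (dvd_mul_left m q) (ZMod m) with hπ
  set uq : (ZMod m)ˣ := ZMod.unitOfCoprime q hmq.symm with huq
  have huqval : (uq : ZMod m) = q := ZMod.coe_unitOfCoprime q hmq.symm
  set y0 : ZMod (q * m) :=
    (q : ZMod (q * m)) * ((((b * uq⁻¹ : (ZMod m)ˣ) : ZMod m).val : ℕ) : ZMod (q * m)) with hy0
  -- (1) the sum over the units is the sum over the unit elements of the fibre
  have h1 : ∑ v ∈ Finset.univ.filter (fun v : (ZMod (q * m))ˣ ↦ ZMod.unitsMap (dvd_mul_left m q) v = b),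
      lev μ (q * m) (v : ZMod (q * m)) =
      ∑ y ∈ (Finset.univ.filter fun y : ZMod (q * m) ↦ π y = b).filter (fun y ↦ IsUnit y),
        lev μ (q * m) y := by
    refine Finset.sum_nbij (fun v : (ZMod (q * m))ˣ ↦ (v : ZMod (q * m))) ?_ ?_ ?_ (fun _ _ ↦ rfl)
    · intro v hv
      have hv' := (Finset.mem_filter.mp hv).2
      refine Finset.mem_filter.mpr ⟨Finset.mem_filter.mpr ⟨Finset.mem_univ _, ?_⟩, Units.isUnit v⟩
      rw [hπ, ZMod.castHom_apply, ← ZMod.unitsMap_val (dvd_mul_left m q), hv']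
    · exact fun _ _ _ _ h ↦ Units.ext h
    · intro y hy
      obtain ⟨hy1, hu⟩ := Finset.mem_filter.mp (Finset.mem_coe.mp hy)
      have hy2 := (Finset.mem_filter.mp hy1).2
      rw [hπ, ZMod.castHom_apply] at hy2
      refine ⟨hu.unit, Finset.mem_coe.mpr (Finset.mem_filter.mpr ⟨Finset.mem_univ _, Units.ext ?_⟩),
        hu.unit_spec⟩
      rw [ZMod.unitsMap_val, hu.unit_spec, hy2]
  -- (2) the non-unit part of the fibre is the single element `y0`
  have h3 : (Finset.univ.filter fun y : ZMod (q * m) ↦ π y = b).filter (fun y ↦ ¬IsUnit y) = {y0} := by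
    ext y
    simp only [Finset.mem_filter, Finset.mem_univ, true_and, Finset.mem_singleton]
    constructor
    · rintro ⟨hy, hnu⟩
      have hcopm : y.val.Coprime m := by
        have hu : IsUnit ((y.val : ℕ) : ZMod m) := by
          have : π y = ((y.val : ℕ) : ZMod m) := by rw [hπ, ZMod.castHom_apply, ZMod.cast_eq_val]
          rw [← this, hy]
          exact Units.isUnit b
        exact (ZMod.isUnit_iff_coprime y.val m).mp hu
      have hncop : ¬y.val.Coprime (q * m) := by
        intro hc
        apply hnu
        rw [← ZMod.natCast_zmod_val y]
        exact (ZMod.isUnit_iff_coprime _ _).mpr hc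
      have hqdvd : q ∣ y.val := by
        by_contra hnd
        exact hncop (Nat.Coprime.mul_right
          (Nat.coprime_comm.mp (hq.coprime_iff_not_dvd.mpr hnd)) hcopm)
      obtain ⟨t, ht⟩ := hqdvd
      have hy' : y = (q : ZMod (q * m)) * (t : ZMod (q * m)) := by
        rw [← ZMod.natCast_zmod_val y, ht, Nat.cast_mul]
      rw [hy', hy0]
      apply mul_eq_mul_of_castHom_eq m q
      rw [map_natCast, map_natCast, ZMod.natCast_zmod_val]
      have hqt : (q : ZMod m) * (t : ZMod m) = (b : ZMod m) := by
        rw [← Nat.cast_mul, ← ht, ← map_natCast π, ZMod.natCast_zmod_val, hy]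
      rw [Units.val_mul]
      calc (t : ZMod m) = ((uq⁻¹ : (ZMod m)ˣ) : ZMod m) * ((uq : ZMod m) * (t : ZMod m)) := by
            rw [← mul_assoc, Units.inv_mul, one_mul]
        _ = (b : ZMod m) * ((uq⁻¹ : (ZMod m)ˣ) : ZMod m) := by rw [huqval, hqt, mul_comm]
    · rintro rfl
      refine ⟨?_, ?_⟩
      · rw [hy0, map_mul, map_natCast, map_natCast, ZMod.natCast_zmod_val, Units.val_mul,
          ← huqval, mul_left_comm, Units.mul_inv, mul_one]
      · intro hu
        have : IsUnit (q : ZMod (q * m)) := isUnit_of_mul_isUnit_left hu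
        exact (ZMod.isUnit_prime_iff_not_dvd hq).mp this (dvd_mul_right q m)
  -- (3) the value at `y0`
  have h4 : lev μ (q * m) y0 = lev μ m ((b * uq⁻¹ : (ZMod m)ˣ) : ZMod m) := by
    rw [hy0, lev_mul_left_eq_lev_castHom hμ m q hq.pos, map_natCast, ZMod.natCast_zmod_val]
  -- (4) assemble
  have h2 := Finset.sum_filter_add_sum_filter_not
    (Finset.univ.filter fun y : ZMod (q * m) ↦ π y = b) (fun y ↦ IsUnit y) (lev μ (q * m))
  rw [h3, Finset.sum_singleton, h4] at h2
  rw [h1, eq_sub_of_add_eq h2, hπ, sum_fibre_lev_heckeTransform hμ m q]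

end Fibres

/-! ### §3 The descent identity with a DEFECT -/

section Descent

variable [CommRing R] {μ : ℚ → R} (ψ : (ℓ : ℕ) → (ZMod ℓ)ˣ →* Multiplicative R)

/-- **THE DESCENT IDENTITY WITH DEFECT.** For `q` prime, `q ∤ m`, `μ` periodic with Hecke transform
`H_q μ = 2μ + ν` (`ν` = the DEFECT of `μ` at `q`; `ν = 0` for an eigenfunction with eigenvalue `2`) and
`T` a set of divisors of `m`:
`Φ_T^{(qm)}(μ) = Φ_T^{(m)}(ν) − ∑_{T' ⊊ T} (∏_{T∖T'} ψ_i(q⁻¹) + ∏_{T∖T'} ψ_i(q)) · Φ_{T'}^{(m)}(μ)`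
— gen 20's `Phi_mul_eq` is the case `ν = 0`. [cite: MazurTateTeitelbaum1986Invent, §I.4 (4.2)] -/
theorem Phi_mul_eq_defect (hμ : IsPeriodic μ) (m q : ℕ) [NeZero m] [NeZero (q * m)] (hq : q.Prime)
    (hmq : m.Coprime q) {ν : ℚ → R} (hν : ∀ r : ℚ, heckeTransform q μ r = 2 * μ r + ν r)
    {T : Finset ℕ} (hT : ∀ i ∈ T, i ∣ m) :
    Phi ψ μ (q * m) T = Phi ψ ν m T - ∑ T' ∈ T.powerset.erase T,
      ((∏ i ∈ T \ T', chi ψ m i (ZMod.unitOfCoprime q hmq.symm)⁻¹) +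
        ∏ i ∈ T \ T', chi ψ m i (ZMod.unitOfCoprime q hmq.symm)) * Phi ψ μ m T' := by
  set uq : (ZMod m)ˣ := ZMod.unitOfCoprime q hmq.symm with huq
  have huqval : (uq : ZMod m) = q := ZMod.coe_unitOfCoprime q hmq.symm
  -- Step 1: fibre by fibre
  have step1 : Phi ψ μ (q * m) T = ∑ b : (ZMod m)ˣ, weight ψ m T b *
      (2 * lev μ m b + lev ν m b - lev μ m ((uq * b : (ZMod m)ˣ) : ZMod m) -
        lev μ m ((uq⁻¹ * b : (ZMod m)ˣ) : ZMod m)) := by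
    unfold Phi
    have hw : ∀ v : (ZMod (q * m))ˣ,
        weight ψ (q * m) T v = weight ψ m T (ZMod.unitsMap (dvd_mul_left m q) v) :=
      fun v ↦ (weight_unitsMap ψ (dvd_mul_left m q) hT v).symm
    simp_rw [hw]
    rw [← Finset.sum_fiberwise Finset.univ
      (fun v : (ZMod (q * m))ˣ ↦ ZMod.unitsMap (dvd_mul_left m q) v)
      (fun v ↦ lev μ (q * m) (v : ZMod (q * m)) *
        weight ψ m T (ZMod.unitsMap (dvd_mul_left m q) v))]
    refine Finset.sum_congr rfl fun b _ ↦ ?_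
    have hinner : ∑ v ∈ Finset.univ.filter
        (fun v : (ZMod (q * m))ˣ ↦ ZMod.unitsMap (dvd_mul_left m q) v = b),
        lev μ (q * m) (v : ZMod (q * m)) * weight ψ m T (ZMod.unitsMap (dvd_mul_left m q) v) =
        (∑ v ∈ Finset.univ.filter
          (fun v : (ZMod (q * m))ˣ ↦ ZMod.unitsMap (dvd_mul_left m q) v = b),
          lev μ (q * m) (v : ZMod (q * m))) * weight ψ m T b := by
      rw [Finset.sum_mul]
      refine Finset.sum_congr rfl fun v hv ↦ ?_
      rw [(Finset.mem_filter.mp hv).2]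
    have hlev : lev (heckeTransform q μ) m (b : ZMod m) = 2 * lev μ m b + lev ν m b := hν _
    rw [hinner, sum_units_fibre_lev_heckeTransform hμ m q hq hmq b, hlev, ← huq,
      mul_comm _ (weight ψ m T b), ← huqval, ← Units.val_mul, mul_comm b uq⁻¹]
  -- Step 2: the two twisted sums
  have hS : ∀ u : (ZMod m)ˣ, ∑ b : (ZMod m)ˣ, weight ψ m T b * lev μ m ((u * b : (ZMod m)ˣ) : ZMod m) =
      Phi ψ μ m T + ∑ T' ∈ T.powerset.erase T, (∏ i ∈ T \ T', chi ψ m i u⁻¹) * Phi ψ μ m T' := by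
    intro u
    have h := sum_lev_unit_mul_weight (μ := μ) ψ m hT u
    rw [← Finset.add_sum_erase _ _ (Finset.mem_powerset_self T), Finset.sdiff_self,
      Finset.prod_empty, one_mul] at h
    rw [← h]
    exact Finset.sum_congr rfl fun b _ ↦ mul_comm _ _
  have hS1 := hS uq
  have hS2 := hS uq⁻¹
  rw [inv_inv] at hS2
  -- Step 3: algebra
  rw [step1]
  have hsplit : ∑ b : (ZMod m)ˣ, weight ψ m T b *
      (2 * lev μ m b + lev ν m b - lev μ m ((uq * b : (ZMod m)ˣ) : ZMod m) -
        lev μ m ((uq⁻¹ * b : (ZMod m)ˣ) : ZMod m)) =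
      2 * Phi ψ μ m T + Phi ψ ν m T -
        ∑ b : (ZMod m)ˣ, weight ψ m T b * lev μ m ((uq * b : (ZMod m)ˣ) : ZMod m) -
        ∑ b : (ZMod m)ˣ, weight ψ m T b * lev μ m ((uq⁻¹ * b : (ZMod m)ˣ) : ZMod m) := by
    simp only [mul_sub, mul_add, Finset.sum_sub_distrib, Finset.sum_add_distrib, Phi, Finset.mul_sum]
    congr 2
    · congr 1
      · exact Finset.sum_congr rfl fun b _ ↦ by ring
      · exact Finset.sum_congr rfl fun b _ ↦ by ring
  rw [hsplit, hS1, hS2]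
  have hcomb : ∑ T' ∈ T.powerset.erase T,
      ((∏ i ∈ T \ T', chi ψ m i uq⁻¹) + ∏ i ∈ T \ T', chi ψ m i uq) * Phi ψ μ m T' =
      ∑ T' ∈ T.powerset.erase T, (∏ i ∈ T \ T', chi ψ m i uq⁻¹) * Phi ψ μ m T' +
        ∑ T' ∈ T.powerset.erase T, (∏ i ∈ T \ T', chi ψ m i uq) * Phi ψ μ m T' := by
    rw [← Finset.sum_add_distrib]
    exact Finset.sum_congr rfl fun _ _ ↦ add_mul _ _ _
  rw [hcomb]
  ring

/-- **`Φ_T^{(n)}(D_U) = 0` for every PROPER subset `T ⊊ P(n)` when the Kurihara numbers of the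
DERIVATIVES vanish.** Data: a family `D U : ℚ → R` of periodic functions indexed by finite sets of
primes (`D U` = the iterated Hecke derivative `∏_{q∈U}(H_q − 2)` of `D ∅`: hypothesis `hD`,
`H_q (D U) = 2·D U + D (U ∪ {q})` at every `P`-prime `q ∉ U`), such that the FULL Kurihara sum
`Φ_{P(m)}^{(m)}(D U)` vanishes for every NON-EMPTY `U` and every square-free `m` with `P`-prime factors
disjoint from `U` (`hvan`). Then for every square-free `n` with `P`-prime factors, every `U` disjoint
from `P(n)` and every `T ⊊ P(n)`: `Φ_T^{(n)}(D U) = 0`. Strong induction on `n` along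
`Phi_mul_eq_defect`: the defect branch lands on a full Kurihara number of a NON-EMPTY derivative or on a
proper `T` at the lower level; the twisted branches shrink `T`. Gen 20's `Phi_eq_zero_of_ssubset` is
the case `D U = 0` (`U ≠ ∅`). [folklore] -/
theorem Phi_eq_zero_of_ssubset_of_derivatives {P : ℕ → Prop}
    (D : Finset ℕ → ℚ → R) (hper : ∀ U, IsPeriodic (D U))
    (hD : ∀ (U : Finset ℕ) (q : ℕ), P q → q ∉ U →
      ∀ r : ℚ, heckeTransform q (D U) r = 2 * D U r + D (insert q U) r)
    (hvan : ∀ (U : Finset ℕ), U.Nonempty → ∀ (m : ℕ) [NeZero m], Squarefree m →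
      (∀ q ∈ m.primeFactors, P q) → Disjoint U m.primeFactors → Phi ψ (D U) m m.primeFactors = 0) :
    ∀ (n : ℕ) [NeZero n] (U T : Finset ℕ), Squarefree n → (∀ q ∈ n.primeFactors, P q) →
      Disjoint U n.primeFactors → T ⊂ n.primeFactors → Phi ψ (D U) n T = 0 := by
  intro n
  induction n using Nat.strong_induction_on with
  | _ n ih =>
  intro _ U T hn hPn hU hT
  obtain ⟨q, hqn, hqT⟩ := Finset.exists_of_ssubset hT
  have hqprime : q.Prime := Nat.prime_of_mem_primeFactors hqn
  obtain ⟨m, rfl⟩ := Nat.dvd_of_mem_primeFactors hqn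
  have hm0 : m ≠ 0 := fun h ↦ NeZero.ne (q * m) (by rw [h, mul_zero])
  haveI : NeZero m := ⟨hm0⟩
  obtain ⟨hcop, -, hsqm⟩ := Nat.squarefree_mul_iff.mp hn
  have hTsub : T ⊆ (q * m).primeFactors := (Finset.ssubset_iff_subset_ne.mp hT).1
  have hTm : ∀ i ∈ T, i ∣ m := by
    intro i hi
    have hi' := hTsub hi
    have hip : i.Prime := Nat.prime_of_mem_primeFactors hi'
    have hidvd : i ∣ q * m := Nat.dvd_of_mem_primeFactors hi'
    rcases (Nat.Prime.dvd_mul hip).mp hidvd with h | h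
    · exact absurd ((Nat.prime_dvd_prime_iff_eq hip hqprime).mp h ▸ hi) hqT
    · exact h
  have hmlt : m < q * m := by
    have := hqprime.one_lt
    have hmpos := Nat.pos_of_ne_zero hm0
    nlinarith
  have hmsub : m.primeFactors ⊆ (q * m).primeFactors :=
    Nat.primeFactors_mono (dvd_mul_left m q) (NeZero.ne (q * m))
  have hPm : ∀ q' ∈ m.primeFactors, P q' := fun q' hq' ↦ hPn q' (hmsub hq')
  have hqU : q ∉ U := fun h ↦ Finset.disjoint_left.mp hU h hqn
  have hqm : q ∉ m.primeFactors := fun h ↦ by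
    have : q ∣ m := Nat.dvd_of_mem_primeFactors h
    exact hqprime.one_lt.ne' (Nat.Coprime.eq_one_of_dvd hcop this)
  have hUm : Disjoint U m.primeFactors := Finset.disjoint_of_subset_right hmsub hU
  have hUqm : Disjoint (insert q U) m.primeFactors := by
    rw [Finset.disjoint_insert_left]
    exact ⟨hqm, hUm⟩
  have hTm' : T ⊆ m.primeFactors := fun i hi ↦
    Nat.mem_primeFactors.mpr ⟨Nat.prime_of_mem_primeFactors (hTsub hi), hTm i hi, hm0⟩
  rw [Phi_mul_eq_defect ψ (hper U) m q hqprime hcop.symm (hD U q (hPn q hqn) hqU) hTm]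
  -- the defect branch
  have hfirst : Phi ψ (D (insert q U)) m T = 0 := by
    rcases hTm'.eq_or_ssubset with hTeq | hTss
    · rw [hTeq]
      exact hvan (insert q U) (Finset.insert_nonempty q U) m hsqm hPm hUqm
    · exact ih m hmlt (insert q U) T hsqm hPm hUqm hTss
  rw [hfirst, Finset.sum_eq_zero, sub_zero]
  -- the twisted branches
  intro T' hT'
  obtain ⟨hne, hsub⟩ := Finset.mem_erase.mp hT'
  have hsub' : T' ⊆ T := Finset.mem_powerset.mp hsub
  have hss : T' ⊂ T := Finset.ssubset_iff_subset_ne.mpr ⟨hsub', hne⟩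
  rw [ih m hmlt U T' hsqm hPm hUm (lt_of_lt_of_le hss hTm'), mul_zero]

/-- **MAIN THEOREM (level lowering kills Kurihara sums WITHOUT the eigen-condition).** Let `D U` be
a derivative family as above (`D ∅ = μ` periodic, `H_q (D U) = 2 D U + D (U ∪ {q})` at the `P`-primes
`q ∉ U`) and suppose the Kurihara numbers `Φ_{P(m)}^{(m)}(D U)` of every NON-EMPTY derivative vanish at
every admissible level. Then for `n` square-free with `P`-prime factors and `ℓ` prime to `n`, the
Kurihara sum of the `ℓ`-old difference `μ − μ∘[ℓ]` at `n` vanishes: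
`∑_{a ∈ (ℤ/n)ˣ} (μ(a/n) − μ(ℓa/n)) · ∏_{q ∣ n} ψ_q(a) = 0`. For an EIGEN `μ` (`D U = 0`, `U ≠ ∅`) this
is gen 20's `kuriharaSum_oldform_eq_zero`; here `μ` need not be eigen — the price is the vanishing of
finitely many Kurihara numbers of its derivatives per level. [cite: Kurihara2014, §1.1 (1)–(2)]
[cite: MazurTateTeitelbaum1986Invent, §I.4 (4.2)] -/
theorem kuriharaSum_oldform_eq_zero_of_derivatives {P : ℕ → Prop}
    (D : Finset ℕ → ℚ → R) (hper : ∀ U, IsPeriodic (D U))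
    (hD : ∀ (U : Finset ℕ) (q : ℕ), P q → q ∉ U →
      ∀ r : ℚ, heckeTransform q (D U) r = 2 * D U r + D (insert q U) r)
    (hvan : ∀ (U : Finset ℕ), U.Nonempty → ∀ (m : ℕ) [NeZero m], Squarefree m →
      (∀ q ∈ m.primeFactors, P q) → Disjoint U m.primeFactors → Phi ψ (D U) m m.primeFactors = 0)
    (n : ℕ) [NeZero n] (hn : Squarefree n) (hPn : ∀ q ∈ n.primeFactors, P q)
    {ℓ : ℕ} (hℓ : ℓ.Coprime n) :
    ∑ a : (ZMod n)ˣ, (D ∅ ((((a : ZMod n).val : ℕ) : ℚ) / n) -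
        D ∅ ((ℓ : ℚ) * ((((a : ZMod n).val : ℕ) : ℚ) / n))) * weight ψ n n.primeFactors a = 0 := by
  set μ := D ∅ with hμdef
  have hμ : IsPeriodic μ := hper ∅
  set u : (ZMod n)ˣ := ZMod.unitOfCoprime ℓ hℓ with hu
  have h1 : ∀ a : (ZMod n)ˣ, μ ((ℓ : ℚ) * ((((a : ZMod n).val : ℕ) : ℚ) / n)) =
      lev μ n ((u * a : (ZMod n)ˣ) : ZMod n) := by
    intro a
    rw [Units.val_mul, hu, ZMod.coe_unitOfCoprime, lev_natCast_mul hμ, mul_div_assoc]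
  have h0 : ∀ a : (ZMod n)ˣ, μ ((((a : ZMod n).val : ℕ) : ℚ) / n) = lev μ n (a : ZMod n) :=
    fun a ↦ rfl
  simp_rw [sub_mul, Finset.sum_sub_distrib, h0, h1]
  rw [sum_lev_unit_mul_weight (μ := μ) ψ n (fun q hq ↦ Nat.dvd_of_mem_primeFactors hq) u,
    ← Finset.add_sum_erase _ _ (Finset.mem_powerset_self _), Finset.sdiff_self, Finset.prod_empty,
    one_mul]
  have hzero : ∀ T' ∈ n.primeFactors.powerset.erase n.primeFactors, Phi ψ μ n T' = 0 := by
    intro T' hT'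
    obtain ⟨hne, hsub⟩ := Finset.mem_erase.mp hT'
    exact Phi_eq_zero_of_ssubset_of_derivatives ψ D hper hD hvan n ∅ T' hn hPn
      (Finset.disjoint_empty_left _)
      (Finset.ssubset_iff_subset_ne.mpr ⟨Finset.mem_powerset.mp hsub, hne⟩)
  rw [Finset.sum_eq_zero (s := n.primeFactors.powerset.erase n.primeFactors)
    (fun T' hT' ↦ by rw [hzero T' hT', mul_zero]), add_zero]
  exact sub_self _

end Descent

end Summit.BirchSwinnertonDyer.Rank1Residual.LevelLowering

end
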